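/-
Copyright (c) 2026 the pub-hodgecm-mathlib formalisation cell (harness21).  Prover seat hodgecm-mathlib-LH4-p17 (g0), req620 Track A «(D-RAM) FOUR-FRAME» squad, helper lane on
h413 = stmt-HodgeConjecture-24833 (count-neutral).  β-BOARD v1 (sub-dealer LH4-p05 (g8)) row R3 «G₁ ε-BOUNDARY TOWER FILE», FILE 4: the three CLASS SUMS over the orbit
representatives `g` of a glued stratum — `Σ ω(g)ω(1+κg)`, `Σ ω(1+κg)`, `Σ ω(1 + κg∕(1+g))` — by rescaling ∕ Möbius reparametrisation of the system and ★ κG-B2's evaluations.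
2026-09-04.
-/
import Summits.HodgeConjecture.HodgeConjecture.Theorems.F0P3cDyRamDiagonalKappaGluedClassSums   -- ★ κG-B2 (LH4-p09 (g3)): `sum_normSign_one_add_boundary`, `…_eq_zero`, `sum_normSign_eq_zero`, `normSign_one_add_eq_of_near`; brings ★ κG-B1 `sum_eq_zero_of_twist`, ★ toolkit
import HarnessLib

/-!
# Crux `H413`, line LH4 «(D-RAM) FOUR-FRAME» — (β) Stage B, R3 FILE 4 «THE ORBIT CHARACTER SUMS OF A BOUNDARY TOWER»

Cell `hodgecm-mathlib` (D-0151), FLOOR 0, crux item H413 = `stmt-HodgeConjecture-24833`, route `HCCMUnconditional`; squad F0∕P3c∕LH4.  THEOREMS ONLY (no `def`, no instance, no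
notation, no `sorry`, default heartbeats); ★-only imports; lane `--supports stmt-HodgeConjecture-24833 --as helper` (count-neutral); pays NO row, states NO law.

THE MATHEMATICS (β-BOARD v1 R3∕R4∕R5; [Serre1979, V §3 ∕ XV §2], [LanglandsShelstad1987, §3]).  `R` is a complete irredundant system of the `σ`-fixed elements of valuation
`|ϖ|^{2t}` modulo `𝔭^{ρ+2t}` (the orbit parameters of the glued stratum `G(2ρ, 2t)`, ★ (iv-c)), `κ` a fixed constant.  The per-orbit labelled odd values beyond the one-slot cell
are `ω(g_β)·(𝟙₀·ω(g)ω(1+rg), 𝟙₁·ω(1+rg), 𝟙₂·ω(−1)ω((1+g)(1+rg)))` (FILE 3 ∕ 3b), so the stratum table needs three sums: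
* §1 RESCALING and the MÖBIUS MAP: `R ↦ κ·R` is a complete irredundant system of level `2t′` modulo `𝔭^{ρ+2t′}` when `|κ|·|ϖ|^{2t} = |ϖ|^{2t′}`; `R ↦ {g∕(1+g)}` is one of the SAME level
  (`|g∕(1+g) − g′∕(1+g′)| = |g − g′|`; `f ↦ f∕(1−f)` inverts it); sums transport by `Finset.sum_image`.
* §2 `Σ_{g ∈ R} ω(1 + κg)`: `= #R` if `|κ|·|ϖ|^{2t} ≤ |ϖ|^{2d−1}` (every `1 + κg` is a deep one-unit); `= −q^{⌈ρ∕2⌉−1}` at the BOUNDARY `|κ|·|ϖ|^{2t} = |ϖ|^{2d−2}` (`ρ ≥ 1`);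
  `= 0` BELOW, `|κ|·|ϖ|^{2t} = |ϖ|^{2t′}`, `t′ + 2 ≤ d`, inside the window `2d ≤ ρ + 2t′ + 1` (★ κG-B2 on `κ·R`).
* §3 the same three for `Σ_{g ∈ R} ω(1 + κ·g∕(1+g))` (★ §2 on the Möbius image) — slot `2` after `(1+g)(1+rg) = (1+g)²·(1 + (r−1)g∕(1+g))`, `normSign_one_add_mul_one_add_eq`.
* §4 `Σ_{g ∈ R} ω(g)·ω(1 + κg) = 0` for `2d ≤ ρ + 1` and `|κ|·|ϖ|^{2t} ≤ |ϖ|` (the non-norm twist `g ↦ n·g` flips `ω(g)` and fixes `ω(1+κg)`; ★ κG-B1 `sum_eq_zero_of_twist`) — slot `0`.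
HONEST LABEL.  Count-neutral; proves no census ((β-BAL)∕(β)∕T₊ OPEN); `HC_CM` is proved only modulo the 7 printed citations (2 remaining named inputs: hLiu418 =
`stmt-HodgeConjecture-24832`, h413 = `stmt-HodgeConjecture-24833`) until rung 0 closes.
-/

set_option autoImplicit false

noncomputable section

namespace Summit.HodgeConjecture.HodgeConjecture.Cruxes.H413.F0P3cDyRamLabelledOddBoundarySums

open WithZero
open Literature.NumberTheory.Automorphic Literature.NumberTheory.Automorphic.UnitaryThreeFourFrame
open Literature.NumberTheory.LocalFields.WildQuadraticDatum
open Summit.HodgeConjecture.HodgeConjecture.Cruxes.H413.F0P3cDyRamDiagonalFixedClassSystems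
open Summit.HodgeConjecture.HodgeConjecture.Cruxes.H413.F0P3cDyRamDiagonalKappaGluedClassSums
open scoped Valued

variable {K : Type} [Field K] [Valued K ℤᵐ⁰]

/-! ## §1  Rescaling and the Möbius map carry systems of representatives to systems of representatives -/

/-- **RESCALED SYSTEM**: if `R` is a complete irredundant system of the fixed elements of valuation `|ϖ|^{2t}` modulo `𝔭^{ρ+2t}` and `κ` is fixed with `|κ|·|ϖ|^{2t} = |ϖ|^{2t′}`, then
`κ·R` is a complete irredundant system of the fixed elements of valuation `|ϖ|^{2t′}` modulo `𝔭^{ρ+2t′}`, and `g ↦ κg` is injective on `R`. [cite: Serre1979, Ch. IV §2 Prop. 6] -/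
theorem image_mul_repr {σ : K →+* K} {ϖ : K} (hϖ0 : ϖ ≠ 0) {ρ t t' : ℕ} (R : Finset K) (hR1 : ∀ g ∈ R, σ g = g ∧ Valued.v g = Valued.v ϖ ^ (2 * t))
    (hR2 : ∀ f : K, σ f = f → Valued.v f = Valued.v ϖ ^ (2 * t) → ∃ g ∈ R, Valued.v (f - g) ≤ Valued.v ϖ ^ (ρ + 2 * t))
    (hR3 : ∀ g ∈ R, ∀ g' ∈ R, Valued.v (g - g') ≤ Valued.v ϖ ^ (ρ + 2 * t) → g = g')
    {κ : K} (hσκ : σ κ = κ) (hκ : Valued.v κ * Valued.v ϖ ^ (2 * t) = Valued.v ϖ ^ (2 * t')) [DecidableEq K] :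
    (∀ h ∈ R.image (fun g => κ * g), σ h = h ∧ Valued.v h = Valued.v ϖ ^ (2 * t')) ∧
      (∀ f : K, σ f = f → Valued.v f = Valued.v ϖ ^ (2 * t') → ∃ h ∈ R.image (fun g => κ * g), Valued.v (f - h) ≤ Valued.v ϖ ^ (ρ + 2 * t')) ∧
      (∀ h ∈ R.image (fun g => κ * g), ∀ h' ∈ R.image (fun g => κ * g), Valued.v (h - h') ≤ Valued.v ϖ ^ (ρ + 2 * t') → h = h') ∧
      Set.InjOn (fun g => κ * g) (R : Set K) := by
  have hvϖ : 0 < Valued.v ϖ := (Valuation.pos_iff _).2 hϖ0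
  have hpt : Valued.v ϖ ^ (2 * t) ≠ 0 := pow_ne_zero _ hvϖ.ne'
  have hκ0 : κ ≠ 0 := fun h => by rw [h, map_zero, zero_mul] at hκ; exact (pow_ne_zero _ hvϖ.ne') hκ.symm
  have hvκ0 : Valued.v κ ≠ 0 := (Valuation.ne_zero_iff _).2 hκ0
  -- `|κ| · |ϖ|^{ρ+2t} = |ϖ|^{ρ+2t′}`
  have hκρ : Valued.v κ * Valued.v ϖ ^ (ρ + 2 * t) = Valued.v ϖ ^ (ρ + 2 * t') := by
    rw [pow_add, mul_left_comm, hκ, ← pow_add]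
  refine ⟨fun h hh => ?_, fun f hσf hvf => ?_, fun h hh h' hh' hle => ?_, fun g _ g' _ hgg' => mul_left_cancel₀ hκ0 hgg'⟩
  · obtain ⟨g, hg, rfl⟩ := Finset.mem_image.1 hh
    exact ⟨by rw [map_mul, hσκ, (hR1 g hg).1], by rw [map_mul, (hR1 g hg).2, hκ]⟩
  · have hvf' : Valued.v (f / κ) = Valued.v ϖ ^ (2 * t) := by
      rw [map_div₀, hvf, div_eq_iff hvκ0, ← hκ, mul_comm]
    obtain ⟨g, hg, hfg⟩ := hR2 (f / κ) (by rw [map_div₀, hσf, hσκ]) hvf'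
    refine ⟨κ * g, Finset.mem_image.2 ⟨g, hg, rfl⟩, ?_⟩
    rw [show f - κ * g = κ * (f / κ - g) by field_simp, map_mul, ← hκρ]
    exact mul_le_mul_right hfg _
  · obtain ⟨g, hg, rfl⟩ := Finset.mem_image.1 hh
    obtain ⟨g', hg', rfl⟩ := Finset.mem_image.1 hh'
    rw [← mul_sub, map_mul, ← hκρ] at hle
    rw [hR3 g hg g' hg' (le_of_mul_le_mul_left hle (zero_lt_iff.2 hvκ0))]

/-- **MÖBIUS SYSTEM**: if `R` is a complete irredundant system of the fixed elements of valuation `|ϖ|^{2t}` (`t ≥ 1`) modulo `𝔭^{ρ+2t}`, so is `{g∕(1+g) : g ∈ R}`, and `g ↦ g∕(1+g)` is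
injective on `R` (`|g∕(1+g) − g′∕(1+g′)| = |g − g′|`; the inverse `f ↦ f∕(1−f)`). [cite: Serre1979, Ch. IV §2 Prop. 6] -/
theorem image_moebius_repr {σ : K →+* K} {ϖ : K} (hϖ1 : Valued.v ϖ < 1) {ρ t : ℕ} (ht : 1 ≤ t) (R : Finset K)
    (hR1 : ∀ g ∈ R, σ g = g ∧ Valued.v g = Valued.v ϖ ^ (2 * t))
    (hR2 : ∀ f : K, σ f = f → Valued.v f = Valued.v ϖ ^ (2 * t) → ∃ g ∈ R, Valued.v (f - g) ≤ Valued.v ϖ ^ (ρ + 2 * t))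
    (hR3 : ∀ g ∈ R, ∀ g' ∈ R, Valued.v (g - g') ≤ Valued.v ϖ ^ (ρ + 2 * t) → g = g') [DecidableEq K] :
    (∀ h ∈ R.image (fun g => g / (1 + g)), σ h = h ∧ Valued.v h = Valued.v ϖ ^ (2 * t)) ∧
      (∀ f : K, σ f = f → Valued.v f = Valued.v ϖ ^ (2 * t) → ∃ h ∈ R.image (fun g => g / (1 + g)), Valued.v (f - h) ≤ Valued.v ϖ ^ (ρ + 2 * t)) ∧
      (∀ h ∈ R.image (fun g => g / (1 + g)), ∀ h' ∈ R.image (fun g => g / (1 + g)), Valued.v (h - h') ≤ Valued.v ϖ ^ (ρ + 2 * t) → h = h') ∧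
      Set.InjOn (fun g => g / (1 + g)) (R : Set K) := by
  have hlt : Valued.v ϖ ^ (2 * t) < 1 := pow_lt_one₀ zero_le hϖ1 (by omega)
  have h1 : ∀ g : K, Valued.v g = Valued.v ϖ ^ (2 * t) → Valued.v (1 + g) = 1 := fun g hg => Valued.v.map_one_add_of_lt (by rw [hg]; exact hlt)
  have h10 : ∀ g : K, Valued.v g = Valued.v ϖ ^ (2 * t) → (1 : K) + g ≠ 0 := fun g hg h0 => by
    have h := h1 g hg; rw [h0, map_zero] at h; exact zero_ne_one h
  -- the distance is preserved
  have hdist : ∀ g g' : K, Valued.v g = Valued.v ϖ ^ (2 * t) → Valued.v g' = Valued.v ϖ ^ (2 * t) →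
      Valued.v (g / (1 + g) - g' / (1 + g')) = Valued.v (g - g') := by
    intro g g' hg hg'
    rw [show g / (1 + g) - g' / (1 + g') = (g - g') / ((1 + g) * (1 + g')) by field_simp [h10 g hg, h10 g' hg']; ring,
      map_div₀, map_mul, h1 g hg, h1 g' hg', mul_one, div_one]
  have hinj : Set.InjOn (fun g => g / (1 + g)) (R : Set K) := by
    intro g hg g' hg' hgg'
    have hg1 := (hR1 g hg).2
    have hg'1 := (hR1 g' hg').2
    have h : Valued.v (g - g') = 0 := by rw [← hdist g g' hg1 hg'1]; simp only [hgg', sub_self, map_zero]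
    exact sub_eq_zero.1 ((Valuation.zero_iff _).1 h)
  refine ⟨fun h hh => ?_, fun f hσf hvf => ?_, fun h hh h' hh' hle => ?_, hinj⟩
  · obtain ⟨g, hg, rfl⟩ := Finset.mem_image.1 hh
    exact ⟨by rw [map_div₀, map_add, map_one, (hR1 g hg).1], by rw [map_div₀, h1 g (hR1 g hg).2, div_one, (hR1 g hg).2]⟩
  · -- invert: `g₀ = f∕(1−f)`
    have h1f : Valued.v (1 - f) = 1 := by
      rw [sub_eq_add_neg]; exact Valued.v.map_one_add_of_lt (by rw [Valuation.map_neg, hvf]; exact hlt)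
    have h1f0 : (1 : K) - f ≠ 0 := fun h0 => by rw [h0, map_zero] at h1f; exact zero_ne_one h1f
    have hvg₀ : Valued.v (f / (1 - f)) = Valued.v ϖ ^ (2 * t) := by rw [map_div₀, h1f, div_one, hvf]
    obtain ⟨g, hg, hfg⟩ := hR2 (f / (1 - f)) (by rw [map_div₀, map_sub, map_one, hσf]) hvg₀
    refine ⟨g / (1 + g), Finset.mem_image.2 ⟨g, hg, rfl⟩, ?_⟩
    have e : f = (f / (1 - f)) / (1 + f / (1 - f)) := by field_simp; ring
    rw [e, hdist _ _ hvg₀ (hR1 g hg).2]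
    exact hfg
  · obtain ⟨g, hg, rfl⟩ := Finset.mem_image.1 hh
    obtain ⟨g', hg', rfl⟩ := Finset.mem_image.1 hh'
    rw [hdist g g' (hR1 g hg).2 (hR1 g' hg').2] at hle
    rw [hR3 g hg g' hg' hle]

/-! ## §2  `Σ_{g ∈ R} ω(1 + κg)`: deep, boundary, below -/

section Sums

variable [CompleteSpace K] [Finite 𝓀[K]] {σ : K →+* K} {ϖ : K} {d t₂ : ℕ}

omit [Finite 𝓀[K]] in
/-- **DEEP**: if `|κ|·|ϖ|^{2t} ≤ |ϖ|^{2d−1}` then every `ω(1 + κg) = 1`, so `Σ_{g ∈ R} ω(1 + κg) = #R`. [cite: Serre1979, Ch. XV §2] -/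
theorem sum_normSign_one_add_mul_eq_card (hD : IsRamifiedQuadraticDatum σ ϖ d t₂) {t : ℕ} (R : Finset K) (hR1 : ∀ g ∈ R, σ g = g ∧ Valued.v g = Valued.v ϖ ^ (2 * t))
    {κ : K} (hσκ : σ κ = κ) (hκ : Valued.v κ * Valued.v ϖ ^ (2 * t) ≤ Valued.v ϖ ^ (2 * d - 1)) :
    ∑ g ∈ R, normSign σ (1 + κ * g) = R.card := by
  rw [Finset.card_eq_sum_ones, Nat.cast_sum, Nat.cast_one]
  refine Finset.sum_congr rfl fun g hg => ?_
  exact normSign_eq_one_of_fixed_of_v_sub_one_le hD (by rw [map_add, map_one, map_mul, hσκ, (hR1 g hg).1]) (n := 2 * d - 1) le_rfl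
    (by rw [add_sub_cancel_left, map_mul, (hR1 g hg).2]; exact hκ)

/-- **BOUNDARY**: if `|κ|·|ϖ|^{2t} = |ϖ|^{2(d−1)}` (`d ≥ 2`, `ρ ≥ 1`) then `Σ_{g ∈ R} ω(1 + κg) = −q^{⌈ρ∕2⌉−1}` (★ κG-B2 `sum_normSign_one_add_boundary` on the rescaled system `κ·R`).
[cite: Serre1979, Ch. V §3 Prop. 5, Cor. 3; Ch. XV §2] [cite: LanglandsShelstad1987, §3] -/
theorem sum_normSign_one_add_mul_boundary (hD : IsRamifiedQuadraticDatum σ ϖ d t₂) (h2 : Valued.v (2 : K) < 1) (hd : 2 ≤ d) {ρ t : ℕ} (hρ : 1 ≤ ρ)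
    (R : Finset K) (hR1 : ∀ g ∈ R, σ g = g ∧ Valued.v g = Valued.v ϖ ^ (2 * t))
    (hR2 : ∀ f : K, σ f = f → Valued.v f = Valued.v ϖ ^ (2 * t) → ∃ g ∈ R, Valued.v (f - g) ≤ Valued.v ϖ ^ (ρ + 2 * t))
    (hR3 : ∀ g ∈ R, ∀ g' ∈ R, Valued.v (g - g') ≤ Valued.v ϖ ^ (ρ + 2 * t) → g = g')
    {κ : K} (hσκ : σ κ = κ) (hκ : Valued.v κ * Valued.v ϖ ^ (2 * t) = Valued.v ϖ ^ (2 * (d - 1))) :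
    ∑ g ∈ R, normSign σ (1 + κ * g) = -((Nat.card 𝓀[K] : ℤ) ^ ((ρ + 1) / 2 - 1)) := by
  classical
  have hϖ0 : ϖ ≠ 0 := fun h0 => by have h := hD.2.2.1; rw [h0, map_zero] at h; exact WithZero.coe_ne_zero h.symm
  obtain ⟨hS1, hS2, hS3, hinj⟩ := image_mul_repr hϖ0 R hR1 hR2 hR3 hσκ hκ
  rw [← Finset.sum_image (f := fun h => normSign σ (1 + h)) hinj]
  exact sum_normSign_one_add_boundary hD h2 hρ (t := d - 1) (by omega) (by omega) _ hS1 hS2 hS3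

/-- **BELOW THE BOUNDARY, INSIDE THE WINDOW**: if `|κ|·|ϖ|^{2t} = |ϖ|^{2t′}` with `1 ≤ t′`, `t′ + 2 ≤ d` and `2d ≤ ρ + 2t′ + 1`, then `Σ_{g ∈ R} ω(1 + κg) = 0` (★ κG-B2 `sum_normSign_one_add_eq_zero`
on `κ·R`; the whole level is stable under `h ↦ n(1+h) − 1`, `n ≡ 1 (ϖ^{2d−2})`, since `2t′ < 2d − 2`). [cite: Serre1979, Ch. V §3 Prop. 5, Cor. 3] [cite: LanglandsShelstad1987, §3] -/
theorem sum_normSign_one_add_mul_eq_zero (hD : IsRamifiedQuadraticDatum σ ϖ d t₂) (h2 : Valued.v (2 : K) < 1) {ρ t t' : ℕ} (ht' : 1 ≤ t') (htd : t' + 2 ≤ d)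
    (hwin : 2 * d ≤ ρ + 2 * t' + 1) (R : Finset K) (hR1 : ∀ g ∈ R, σ g = g ∧ Valued.v g = Valued.v ϖ ^ (2 * t))
    (hR2 : ∀ f : K, σ f = f → Valued.v f = Valued.v ϖ ^ (2 * t) → ∃ g ∈ R, Valued.v (f - g) ≤ Valued.v ϖ ^ (ρ + 2 * t))
    (hR3 : ∀ g ∈ R, ∀ g' ∈ R, Valued.v (g - g') ≤ Valued.v ϖ ^ (ρ + 2 * t) → g = g')
    {κ : K} (hσκ : σ κ = κ) (hκ : Valued.v κ * Valued.v ϖ ^ (2 * t) = Valued.v ϖ ^ (2 * t')) :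
    ∑ g ∈ R, normSign σ (1 + κ * g) = 0 := by
  classical
  obtain ⟨-, hvσ, hϖ, -, -, -, -⟩ := id hD
  have hϖ0 : ϖ ≠ 0 := fun h0 => by rw [h0, map_zero] at hϖ; exact WithZero.coe_ne_zero hϖ.symm
  have hϖ1 : Valued.v ϖ < 1 := by rw [hϖ, ← exp_zero, exp_lt_exp]; norm_num
  obtain ⟨hS1, hS2, hS3, hinj⟩ := image_mul_repr hϖ0 R hR1 hR2 hR3 hσκ hκ
  rw [← Finset.sum_image (f := fun h => normSign σ (1 + h)) hinj]
  refine sum_normSign_one_add_eq_zero hD h2 ht' hwin (A := {x : K | σ x = x ∧ Valued.v x = Valued.v ϖ ^ (2 * t')}) (fun g hg => hg) ?_ _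
    (fun h hh => hS1 h hh) (fun f hf => hS2 f hf.1 hf.2) hS3
  -- stability of the level under the twist `h ↦ n(1+h) − 1`
  rintro g ⟨hσg, hvg⟩ n hσn hn1 hnd
  refine ⟨by rw [map_sub, map_mul, map_add, map_one, hσn, hσg], ?_⟩
  rw [show n * (1 + g) - 1 = g + (n - 1) * (1 + g) by ring]
  have hsmall : Valued.v ((n - 1) * (1 + g)) < Valued.v g := by
    rw [map_mul, Valued.v.map_one_add_of_lt (by rw [hvg]; exact pow_lt_one₀ zero_le hϖ1 (by omega)), mul_one, hvg]
    exact hnd.trans_lt (pow_lt_pow_right_of_lt_one₀ ((Valuation.pos_iff _).2 hϖ0) hϖ1 (by omega))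
  rw [Valuation.map_add_eq_of_lt_left _ hsmall, hvg]

/-! ## §3  The same sums through the Möbius map, and `ω((1+g)(1+rg)) = ω(1 + (r−1)g∕(1+g))` -/

omit [CompleteSpace K] [Finite 𝓀[K]] in
/-- **`ω((1+g)(1+rg)) = ω(1 + (r−1)·g∕(1+g))`** for fixed `g, r` with `|g| < 1`: `(1+g)(1+rg) = (1+g)²·(1 + (r−1)g∕(1+g))` and `(1+g)² = (1+g)·σ(1+g)` is a norm.
[cite: Serre1979, Ch. V §3 Cor. 3] -/
theorem normSign_one_add_mul_one_add_eq (σ : K →+* K) {g r : K} (hσg : σ g = g) (hg : Valued.v g < 1) :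
    normSign σ ((1 + g) * (1 + r * g)) = normSign σ (1 + (r - 1) * (g / (1 + g))) := by
  have h1g : Valued.v (1 + g) = 1 := Valued.v.map_one_add_of_lt hg
  have h1g0 : (1 : K) + g ≠ 0 := fun h0 => by rw [h0, map_zero] at h1g; exact zero_ne_one h1g
  have e : (1 + g) * (1 + r * g) = (1 + (r - 1) * (g / (1 + g))) * ((1 + g) * σ (1 + g)) := by
    rw [map_add, map_one, hσg]; field_simp; ring
  rw [e, Summit.HodgeConjecture.HodgeConjecture.Cruxes.H413.F0P3cDyRamFixedCountDiagonalModel.normSign_mul_norm σ _ h1g0]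

omit [Finite 𝓀[K]] in
/-- **DEEP, Möbius form**: `|κ|·|ϖ|^{2t} ≤ |ϖ|^{2d−1}` ⟹ `Σ_{g ∈ R} ω(1 + κ·g∕(1+g)) = #R` (`t ≥ 1`). [cite: Serre1979, Ch. XV §2] -/
theorem sum_normSign_one_add_mul_moebius_eq_card (hD : IsRamifiedQuadraticDatum σ ϖ d t₂) {t : ℕ} (ht : 1 ≤ t) (R : Finset K)
    (hR1 : ∀ g ∈ R, σ g = g ∧ Valued.v g = Valued.v ϖ ^ (2 * t))
    {κ : K} (hσκ : σ κ = κ) (hκ : Valued.v κ * Valued.v ϖ ^ (2 * t) ≤ Valued.v ϖ ^ (2 * d - 1)) :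
    ∑ g ∈ R, normSign σ (1 + κ * (g / (1 + g))) = R.card := by
  have hϖ := hD.2.2.1
  have hϖ1 : Valued.v ϖ < 1 := by rw [hϖ, ← exp_zero, exp_lt_exp]; norm_num
  rw [Finset.card_eq_sum_ones, Nat.cast_sum, Nat.cast_one]
  refine Finset.sum_congr rfl fun g hg => ?_
  have h1g : Valued.v (1 + g) = 1 := Valued.v.map_one_add_of_lt (by rw [(hR1 g hg).2]; exact pow_lt_one₀ zero_le hϖ1 (by omega))
  exact normSign_eq_one_of_fixed_of_v_sub_one_le hD (by rw [map_add, map_one, map_mul, hσκ, map_div₀, map_add, map_one, (hR1 g hg).1]) (n := 2 * d - 1) le_rfl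
    (by rw [add_sub_cancel_left, map_mul, map_div₀, h1g, div_one, (hR1 g hg).2]; exact hκ)

/-- **BOUNDARY, Möbius form**: `|κ|·|ϖ|^{2t} = |ϖ|^{2(d−1)}`, `d ≥ 2`, `ρ, t ≥ 1` ⟹ `Σ_{g ∈ R} ω(1 + κ·g∕(1+g)) = −q^{⌈ρ∕2⌉−1}`. [cite: Serre1979, Ch. V §3 Prop. 5, Cor. 3; Ch. XV §2] -/
theorem sum_normSign_one_add_mul_moebius_boundary (hD : IsRamifiedQuadraticDatum σ ϖ d t₂) (h2 : Valued.v (2 : K) < 1) (hd : 2 ≤ d) {ρ t : ℕ} (hρ : 1 ≤ ρ) (ht : 1 ≤ t)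
    (R : Finset K) (hR1 : ∀ g ∈ R, σ g = g ∧ Valued.v g = Valued.v ϖ ^ (2 * t))
    (hR2 : ∀ f : K, σ f = f → Valued.v f = Valued.v ϖ ^ (2 * t) → ∃ g ∈ R, Valued.v (f - g) ≤ Valued.v ϖ ^ (ρ + 2 * t))
    (hR3 : ∀ g ∈ R, ∀ g' ∈ R, Valued.v (g - g') ≤ Valued.v ϖ ^ (ρ + 2 * t) → g = g')
    {κ : K} (hσκ : σ κ = κ) (hκ : Valued.v κ * Valued.v ϖ ^ (2 * t) = Valued.v ϖ ^ (2 * (d - 1))) :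
    ∑ g ∈ R, normSign σ (1 + κ * (g / (1 + g))) = -((Nat.card 𝓀[K] : ℤ) ^ ((ρ + 1) / 2 - 1)) := by
  classical
  have hϖ := hD.2.2.1
  have hϖ1 : Valued.v ϖ < 1 := by rw [hϖ, ← exp_zero, exp_lt_exp]; norm_num
  obtain ⟨hS1, hS2, hS3, hinj⟩ := image_moebius_repr (σ := σ) hϖ1 ht R hR1 hR2 hR3
  rw [← Finset.sum_image (f := fun h => normSign σ (1 + κ * h)) hinj]
  exact sum_normSign_one_add_mul_boundary hD h2 hd hρ _ hS1 hS2 hS3 hσκ hκ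

/-- **BELOW, Möbius form**: `|κ|·|ϖ|^{2t} = |ϖ|^{2t′}`, `1 ≤ t′`, `t′ + 2 ≤ d`, `2d ≤ ρ + 2t′ + 1`, `t ≥ 1` ⟹ `Σ_{g ∈ R} ω(1 + κ·g∕(1+g)) = 0`. [cite: Serre1979, Ch. V §3 Prop. 5, Cor. 3] -/
theorem sum_normSign_one_add_mul_moebius_eq_zero (hD : IsRamifiedQuadraticDatum σ ϖ d t₂) (h2 : Valued.v (2 : K) < 1) {ρ t t' : ℕ} (ht : 1 ≤ t) (ht' : 1 ≤ t')
    (htd : t' + 2 ≤ d) (hwin : 2 * d ≤ ρ + 2 * t' + 1) (R : Finset K) (hR1 : ∀ g ∈ R, σ g = g ∧ Valued.v g = Valued.v ϖ ^ (2 * t))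
    (hR2 : ∀ f : K, σ f = f → Valued.v f = Valued.v ϖ ^ (2 * t) → ∃ g ∈ R, Valued.v (f - g) ≤ Valued.v ϖ ^ (ρ + 2 * t))
    (hR3 : ∀ g ∈ R, ∀ g' ∈ R, Valued.v (g - g') ≤ Valued.v ϖ ^ (ρ + 2 * t) → g = g')
    {κ : K} (hσκ : σ κ = κ) (hκ : Valued.v κ * Valued.v ϖ ^ (2 * t) = Valued.v ϖ ^ (2 * t')) :
    ∑ g ∈ R, normSign σ (1 + κ * (g / (1 + g))) = 0 := by
  classical
  have hϖ := hD.2.2.1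
  have hϖ1 : Valued.v ϖ < 1 := by rw [hϖ, ← exp_zero, exp_lt_exp]; norm_num
  obtain ⟨hS1, hS2, hS3, hinj⟩ := image_moebius_repr (σ := σ) hϖ1 ht R hR1 hR2 hR3
  rw [← Finset.sum_image (f := fun h => normSign σ (1 + κ * h)) hinj]
  exact sum_normSign_one_add_mul_eq_zero hD h2 ht' htd hwin _ hS1 hS2 hS3 hσκ hκ

/-! ## §4  The own slot: `Σ_{g ∈ R} ω(g)·ω(1 + κg) = 0` -/

/-- **`Σ_{g ∈ R} ω(g)·ω(1 + κg) = 0`** for `2d ≤ ρ + 1` and `|κ|·|ϖ|^{2t} ≤ |ϖ|` (`κ` fixed): the twist `g ↦ n·g` by the fixed non-norm `n ≡ 1 (ϖ^{2d−2})` of ★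
`exists_fixed_unit_not_norm_v_sub_one_le` flips `ω(g)` and fixes `ω(1 + κg)` (`|κg(n−1)| ≤ |ϖ|^{2d−1}`); both factors are class functions at this resolution. ★ κG-B2
`sum_normSign_mul_normSign_one_add_eq_zero` is the case `κ = 1`. [cite: Serre1979, Ch. V §3 Prop. 5, Cor. 3] [cite: LanglandsShelstad1987, §3] -/
theorem sum_normSign_mul_normSign_one_add_mul_eq_zero (hD : IsRamifiedQuadraticDatum σ ϖ d t₂) (h2 : Valued.v (2 : K) < 1) {ρ t : ℕ} (hρ : 2 * d ≤ ρ + 1)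
    (R : Finset K) (hR1 : ∀ g ∈ R, σ g = g ∧ Valued.v g = Valued.v ϖ ^ (2 * t))
    (hR2 : ∀ f : K, σ f = f → Valued.v f = Valued.v ϖ ^ (2 * t) → ∃ g ∈ R, Valued.v (f - g) ≤ Valued.v ϖ ^ (ρ + 2 * t))
    (hR3 : ∀ g ∈ R, ∀ g' ∈ R, Valued.v (g - g') ≤ Valued.v ϖ ^ (ρ + 2 * t) → g = g')
    {κ : K} (hσκ : σ κ = κ) (hκ : Valued.v κ * Valued.v ϖ ^ (2 * t) ≤ Valued.v ϖ) :
    ∑ g ∈ R, normSign σ g * normSign σ (1 + κ * g) = 0 := by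
  obtain ⟨-, hvσ, hϖ, -, -, hd1, -⟩ := id hD
  have hϖ0 : ϖ ≠ 0 := fun h0 => by rw [h0, map_zero] at hϖ; exact WithZero.coe_ne_zero hϖ.symm
  have hvϖ : 0 < Valued.v ϖ := (Valuation.pos_iff _).2 hϖ0
  have hϖ1 : Valued.v ϖ < 1 := by rw [hϖ, ← exp_zero, exp_lt_exp]; norm_num
  have hmono : ∀ {a b : ℕ}, a ≤ b → Valued.v ϖ ^ b ≤ Valued.v ϖ ^ a := fun h => pow_le_pow_right_of_le_one' hϖ1.le h
  set A : Set K := {x : K | σ x = x ∧ Valued.v x = Valued.v ϖ ^ (2 * t)} with hAdef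
  have hA : ∀ g ∈ A, σ g = g ∧ Valued.v g = Valued.v ϖ ^ (2 * t) := fun g hg => hg
  -- `1 + κg` is a fixed unit on the level, and `ω(1+κg)` a class function modulo `𝔭^{ρ+2t}`
  have hκlt : ∀ f ∈ A, Valued.v (κ * f) < 1 := fun f hf => by
    rw [map_mul, hf.2]; exact hκ.trans_lt hϖ1
  have hσ1 : ∀ f ∈ A, σ (1 + κ * f) = 1 + κ * f := fun f hf => by rw [map_add, map_one, map_mul, hσκ, hf.1]
  have hcls : ∀ f ∈ A, ∀ f' ∈ A, Valued.v (f - f') ≤ Valued.v ϖ ^ (ρ + 2 * t) → normSign σ (1 + κ * f') = normSign σ (1 + κ * f) := by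
    intro f hf f' hf' h
    refine normSign_eq_of_near hD (hσ1 f hf) (hσ1 f' hf') (Valued.v.map_one_add_of_lt (hκlt f hf)) (n := ρ + 1) (by omega) ?_
    rw [show (1 : K) + κ * f - (1 + κ * f') = κ * (f - f') by ring, map_mul]
    calc Valued.v κ * Valued.v (f - f') ≤ Valued.v κ * Valued.v ϖ ^ (ρ + 2 * t) := mul_le_mul_right h _
      _ = Valued.v κ * Valued.v ϖ ^ (2 * t) * Valued.v ϖ ^ ρ := by rw [pow_add, mul_comm (Valued.v ϖ ^ ρ), mul_assoc]
      _ ≤ Valued.v ϖ * Valued.v ϖ ^ ρ := mul_le_mul_left hκ _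
      _ = Valued.v ϖ ^ (ρ + 1) := by rw [pow_succ, mul_comm]
  obtain ⟨n, hσn, hn1, hnd, hnn⟩ := exists_fixed_unit_not_norm_v_sub_one_le hD h2
  have hnd' : Valued.v (n - 1) ≤ Valued.v ϖ ^ (2 * (d - 1)) := by
    rw [v_varpi_pow hϖ]; convert hnd using 2; push_cast; ring
  refine sum_eq_zero_of_twist (A := A) (r := Valued.v ϖ ^ (ρ + 2 * t)) R (fun g hg => hR1 g hg) (fun f hf => hR2 f hf.1 hf.2) hR3
    (fun g => normSign σ g * normSign σ (1 + κ * g)) (fun f hf f' hf' h => ?_) (fun g => n * g)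
    (fun f hf => ⟨by rw [map_mul, hσn, hf.1], by rw [map_mul, hn1, one_mul, hf.2]⟩) (fun f _ f' _ h => ?_) (fun f hf => ?_)
  · rw [(normSign_eq_of_near_level hD hρ (hA f hf).1 (hA f' hf').1 (hA f hf).2 h).symm, hcls f hf f' hf' h]
  · rwa [← mul_sub, map_mul, hn1, one_mul] at h
  · have hf0 : f ≠ 0 := fun h0 => by have h := (hA f hf).2; rw [h0, map_zero] at h; exact (pow_ne_zero _ hvϖ.ne') h.symm
    have hnear : Valued.v ((1 + κ * f) - (1 + κ * (n * f))) ≤ Valued.v ϖ ^ (2 * d - 1) := by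
      rw [show (1 : K) + κ * f - (1 + κ * (n * f)) = -((n - 1) * (κ * f)) by ring, Valuation.map_neg, map_mul, map_mul, (hA f hf).2]
      calc Valued.v (n - 1) * (Valued.v κ * Valued.v ϖ ^ (2 * t)) ≤ Valued.v ϖ ^ (2 * (d - 1)) * Valued.v ϖ := mul_le_mul' hnd' hκ
        _ = Valued.v ϖ ^ (2 * d - 1) := by rw [← pow_succ]; congr 1; omega
    rw [normSign_mul_eq_neg_of_not_norm hD hσn hnn (hA f hf).1 hf0,
      normSign_eq_of_near hD (hσ1 f hf) (by rw [map_add, map_one, map_mul, map_mul, hσκ, hσn, hf.1]) (Valued.v.map_one_add_of_lt (hκlt f hf)) (n := 2 * d - 1) le_rfl hnear]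
    ring

end Sums

end Summit.HodgeConjecture.HodgeConjecture.Cruxes.H413.F0P3cDyRamLabelledOddBoundarySums

end
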